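import Summits.QuantumAdvantage.AdviceFreeQNC0.AffBells30Drop

/-!
# Joint-phase certificate — part 3/3: §C.7 block balance `HBlock → HDrop`, §C.8 the part-parity form `HPart`

VERBATIM split (400-line rule) of planner qa-qnc0-p1 g30's `HOME/qa-qnc0-p1/exp30/Cert30.lean` (sha16 `d540ad8703b716ed`, 715 lines = the referee's
pin `Cert30.pre3final.lean`; farm rc 0 / 0 sorry / 0 warnings; authored AND proved by the planner seat; landed by qn-prover-3 g15, ask P-30c) into
`AffBells30Cert.lean` (§C.1–§C.3), `AffBells30Drop.lean` (§C.4–§C.6), `AffBells30Block.lean` (§C.7–§C.8); only file boundaries, per-file preambles,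
these header lines and one-line docstrings on undocumented auxiliaries are new.  NOTE: `HWideE`/`HCert` (§C.6) are labelled REFUTED-AS-TYPED records
by the planner; the live conjectures are `HDrop` (§C.5) ⇐ `HBlock` (§C.7) ⇐ `HPart` (§C.8).  The planner's module docstring follows.

# Cert30 (planner qn-p1 g30, ROUND-29): the JOINT-PHASE CERTIFICATE engine (PROVED), the DROP-SET form `HDrop` of the wide-parity
conjecture (`HDrop → HAbs → (NP₁)` PROVED), and the BLOCK-BALANCE form `HBlock` (`HBlock → HDrop` PROVED)

Context.  The frame-shadow / transfer reduction (`AffBells29Shadow`, `AffBells29Transfer`, tree) leaves ONE conjecture feeding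
`HAbs`: far affine strategies with few coin-pair cut points admit a low-degree competitor for the firing PARITY.  ROUND-29 (this
round) REFUTES every THRESHOLD-defined form of that conjecture (tree `AffBells29.HWide` with the fixed width `C·log₂N`; the
width-existential `HWideE` and the threshold certificate `HCert` of §C.6; `AffBells29.HShape`): sparse-core pure run tilings (lit L-36
own-position designs on random sparse ±1 cores of ANY width `s`, graded over `s ∈ [0, C log N]`) are far, have NO cut points, and violate
`WideParityAt w` at ≈ 50 % of the odd class for every `w` they straddle (R3; numerics K-44p / `grt_check*.py`).  What survives is the
tree's `HAbs` (competitor `z'` FREE): for those tilings `z'` = «drop whole runs» works.  Hence the live forms below let the PLANNER choose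
the set `D` of dropped rows per `(N, β, c)` (whole twin blocks, never a width threshold); the only constraint is that the KEPT rows are
polylog-narrow (so that `readsOnly_shadow`/`bitFn_drop_lowDeg` give the low-degree competitor).

* §C.1–C.3 THE ENGINE (c enters only through `x ∉ cutPoints β c`; radius ONE).  Data at an odd point `x`: a partition `s` of the
  active rows each part inside or disjoint from the designated set `W`, coin pairs `P`, a shift table `δ` with every pair shifting every
  row of a part uniformly (`UniformShift`), and the CERTIFICATE parities (`CertShapeW W β x`: the number of pairs shifting part `k` by `+1`,
  resp. by `−1`, is odd iff `k ⊆ W`).  **`desigParity_of_cert` (PROVED):** `x ∉ cutPoints β c ∧ CertShapeW W β x ⇒ DesigParityAt W β c x`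
  (the rows of `W` fire with parity `≡ |W ∩ act x|`).  Linear-algebra reading: purity at `x` ⟺ the imbalance vector `(A,B)(x)` lies in
  the nullspace of the pair/class incidence matrix `E(x)` over `𝔽₂`; the certificate ⟺ `(𝟙_W,𝟙_W) ∈ rowspace E(x)`.  Census K-44p
  (j317453, 16 families, N ≤ 192, 300 points/cell): the certificate holds at 1.00 of CLEAN points (no class mixing designated and kept
  rows, no coin-poor designated row) in every family from N = 72 on, frames included; it fails exactly at mixed classes and coin-poor rows.
* §C.4–C.5 THE DROP-SET FORM.  `dropRow/dropOff/dropAct/DropParityAt`; `dropParity_of_cert`; **`HDrop`** := far ∧ few cut points ⇒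
  `∃ D` (kept rows of width `≤ (log₂N)^C`) with `DropParityAt D` at all but `ε·2^{N−1}` odd points; **`hAbs_of_hDrop`, `polyLoss_of_hDrop`
  (PROVED)**.  RISK R4 (NESTED-RUN CHAINS, numerics `r4_check.py`): pure runs on nested cores `v₁ ⊂ v₂ ⊂ …` are far and cut-free, `HDrop`
  holds with `D` = the runs above any core-width threshold, but the boundary runs MERGE into one coin class at ≈ 2/3 of the points, where
  no pointwise certificate exists (cert 0.38 vs DropParity 1.00 at N = 96): the certificate is a LEMMA for generic points, not the theorem.
* §C.7 THE BLOCK-BALANCE FORM (the statement the proof architecture of ROUND-29 §6 actually targets).  `BlockBalancedAt L D β c x`: the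
  designated active rows split into parts, each COHERENT (sign-twins on the coins outside a set of ≤ L positions — a common phase) and
  SIGNED-PHASE-BALANCED (its three phase counts have equal parity); **`blockBalanced_dropParity` (PROVED)**; **`HBlock`** := far ∧ few cut
  points ⇒ `∃ D`, block balance a.e.; **`hDrop_of_hBlock`, `polyLoss_of_hBlock` (PROVED)**.  Per-CLASS balance is FALSE for pure non-twin
  designs (lit `nbr2s6`, `s7a`: 0/40, 2/40 points) while whole RUNS are balanced parts — hence parts are coherent blocks, not classes.
* §C.8 THE PART-PARITY FORM `HPart` (the weakest typed target): coherent parts each firing with parity `≡` its size; **`partParity_dropParity`,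
  `blockBalanced_partParity`, `partParity_of_cert` (= the engine, part by part), `hDrop_of_hPart`, `hPart_of_hBlock`, `polyLoss_of_hPart` (PROVED)** — so
  `HBlock → HPart → HDrop → HAbs → (NP₁)`, and a prover may target whichever of the three is most convenient.
* §C.6 RECORD ONLY: `HWideE`, `HCert` (REFUTED AS TYPED, R3) with their true implications, kept so the refutation has a typed referent.

WHAT THIS IS NOT: no claim about the crux `RingDenseResidualLt3`; `HDrop`/`HBlock` are conjectures (typed, unproved); nothing here
touches the route file; separation NOT moved.
-/

noncomputable section

open Classical

namespace Summit.QuantumAdvantage.AdviceFreeQNC0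

namespace AffBells30

open Finset Literature.Computability.QuantumComplexity Literature.Computability.QuantumComplexity.RingHLF
open Literature.Computability.MetaComplexity Literature.Computability.MetaComplexity.Smolensky
open AffBells23 AffBells26 Fib19 AffBells27 AffBells28 AffBells29

variable {N : ℕ}


/-! ### §C.7 The BLOCK-BALANCE form `HBlock` (ROUND-29 §6): coherent signed-balanced parts ⇒ drop parity (PROVED); `HBlock → HDrop` -/

/-- Signed phase count: the rows of `k` that fire when the common phase is advanced by `t` (row `g` moves by `ε g * t`). -/
def sPhaseCount (β : Fin N → Fin N → ZMod 3) (c : Fin N → ZMod 3) (x : Fin N → Bool) (ε : Fin N → ZMod 3)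
    (k : Finset (Fin N)) (t : ZMod 3) : ℕ :=
  (k.filter fun g => form β x g + ε g * t = c g).card

/-- Auxiliary `sPhaseCount_zero` of the joint-phase certificate engine (planner qa-qnc0-p1 g30, `Cert30.lean`, verbatim). -/
theorem sPhaseCount_zero (β : Fin N → Fin N → ZMod 3) (c : Fin N → ZMod 3) (x : Fin N → Bool) (ε : Fin N → ZMod 3)
    (k : Finset (Fin N)) : sPhaseCount β c x ε k 0 = fires β c k x := by
  unfold sPhaseCount fires
  simp only [mul_zero, add_zero]

/-- With unit signs the three signed phase counts partition `k`. -/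
theorem sPhaseCount_sum (β : Fin N → Fin N → ZMod 3) (c : Fin N → ZMod 3) (x : Fin N → Bool) {ε : Fin N → ZMod 3}
    {k : Finset (Fin N)} (hε : ∀ g ∈ k, ε g = 1 ∨ ε g = 2) :
    sPhaseCount β c x ε k 0 + sPhaseCount β c x ε k 1 + sPhaseCount β c x ε k 2 = k.card := by
  have key1 : ∀ e u v : ZMod 3, (e = 1 ∨ e = 2) → ((¬ u + e * 0 = v ∧ u + e * 1 = v) ↔ u + e * 1 = v) := by decide
  have key2 : ∀ e u v : ZMod 3, (e = 1 ∨ e = 2) → ((¬ u + e * 0 = v ∧ ¬ u + e * 1 = v) ↔ u + e * 2 = v) := by decide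
  unfold sPhaseCount
  rw [← card_filter_add_card_filter_not (s := k) (fun g => form β x g + ε g * 0 = c g), add_assoc]
  congr 1
  rw [← card_filter_add_card_filter_not (s := k.filter fun g => ¬ form β x g + ε g * 0 = c g)
      (fun g => form β x g + ε g * 1 = c g), filter_filter, filter_filter]
  congr 1
  · congr 1; exact filter_congr fun g hg => (key1 _ _ _ (hε g hg)).symm
  · congr 1; exact filter_congr fun g hg => (key2 _ _ _ (hε g hg)).symm

/-- A part `k` is COHERENT off `T` (with signs `ε`): its rows are sign-twins on every coin of `x` outside `T` — so they share ONE phase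
(the signed coin sum outside `T`; positions of `T` belong to the part's own window and are read into its pattern). -/
def CoherentOff (T : Finset (Fin N)) (ε : Fin N → ZMod 3) (β : Fin N → Fin N → ZMod 3) (x : Fin N → Bool) (k : Finset (Fin N)) :
    Prop :=
  ∀ b ∈ k, ∀ b' ∈ k, ∀ i ∈ klineZeros x, i ∉ T → ε b * β b i = ε b' * β b' i

/-- A part is SIGNED-PHASE-BALANCED: its three signed phase counts have equal parity (for a designed pure run: the design fires with
parity `≡` its active size at every phase). -/
def SBalanced (ε : Fin N → ZMod 3) (β : Fin N → Fin N → ZMod 3) (c : Fin N → ZMod 3) (x : Fin N → Bool) (k : Finset (Fin N)) : Prop :=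
  (sPhaseCount β c x ε k 0 : ZMod 2) = sPhaseCount β c x ε k 1 ∧ (sPhaseCount β c x ε k 0 : ZMod 2) = sPhaseCount β c x ε k 2

/-- BLOCK BALANCE at `x` for the drop set `D` with coherence budget `L`: the designated active rows `dropAct D x` split into pairwise
disjoint parts, with unit signs, each part coherent off at most `L` positions and signed-phase-balanced. -/
def BlockBalancedAt (L : ℕ) (D : Finset (Fin N)) (β : Fin N → Fin N → ZMod 3) (c : Fin N → ZMod 3) (x : Fin N → Bool) : Prop :=
  ∃ (s : Finset (Finset (Fin N))) (ε : Fin N → ZMod 3) (T : Finset (Fin N) → Finset (Fin N)),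
    (∀ k ∈ s, ∀ k' ∈ s, k ≠ k' → Disjoint k k') ∧ s.biUnion id = dropAct D x ∧
    (∀ b ∈ dropAct D x, ε b = 1 ∨ ε b = 2) ∧
    (∀ k ∈ s, (T k).card ≤ L ∧ CoherentOff (T k) ε β x k) ∧
    (∀ k ∈ s, SBalanced ε β c x k)

/-- **Block balance forces drop parity (PROVED).**  Only disjointness, unit signs and the balance are used — coherence is what makes
`HBlock` a contentful conjecture (without it, pairs of arbitrary non-firing rows would be «balanced parts»). -/
theorem blockBalanced_dropParity {L : ℕ} {D : Finset (Fin N)} {β : Fin N → Fin N → ZMod 3} {c : Fin N → ZMod 3}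
    {x : Fin N → Bool} (h : BlockBalancedAt L D β c x) : DropParityAt D β c x := by
  obtain ⟨s, ε, T, hdisj, hU, hε, -, hbal⟩ := h
  have key : ∀ u v : ZMod 2, v = u + u + u → u = v := by decide
  have hpart : ∀ k ∈ s, (fires β c k x : ZMod 2) = (k.card : ZMod 2) := by
    intro k hk
    have hεk : ∀ g ∈ k, ε g = 1 ∨ ε g = 2 := fun g hg =>
      hε g (by rw [← hU, mem_biUnion]; exact ⟨k, hk, hg⟩)
    have hsum : (k.card : ZMod 2) = (sPhaseCount β c x ε k 0 : ZMod 2) + sPhaseCount β c x ε k 1 + sPhaseCount β c x ε k 2 := by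
      rw [← (sPhaseCount_sum β c x hεk)]; push_cast; rfl
    rw [← (hbal k hk).1, ← (hbal k hk).2] at hsum
    rw [← sPhaseCount_zero β c x ε k]
    exact key _ _ hsum
  unfold DropParityAt DesigParityAt
  have hcard : (s.biUnion id).card = ∑ k ∈ s, k.card := card_biUnion hdisj
  rw [← ZMod.natCast_eq_natCast_iff', ← hU, fires_biUnion β c x s hdisj, hcard]
  push_cast
  exact sum_congr rfl fun k hk => hpart k hk

/-- **`HBlock`** — the BLOCK-BALANCE form of the wide-parity conjecture (ROUND-29 §6; `c` enters only through the cut-point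
hypothesis and the balance conclusion).  Far ∧ few cut points ⇒ the planner can choose a drop set `D` whose complement is
polylog-narrow such that at all but `ε·2^{N−1}` odd points the designated active rows split into coherent signed-balanced blocks.
Why it might fail: a far a.e.-pure strategy whose wide twin blocks are individually UNBALANCED with imbalances cancelling inside the
nullspace of the pair/class matrix at a positive fraction of points (merged or cyclically linked blocks); the ROUND-29 §6 peeling argument
says own-position link chains are acyclic so some block is always learnable in isolation — unproved. -/
def HBlock : Prop :=
  ∃ δ₀ : ℝ, δ₀ < 1 / 2 ∧ ∃ r₀ w₀ : ℕ, ∀ ε : ℝ, 0 < ε → ∃ C a n₀ : ℕ, ∀ N ≥ n₀, ∀ (β : Fin N → Fin N → ZMod 3) (c : Fin N → ZMod 3),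
    ¬ FrameDecomp δ₀ r₀ w₀ β →
    ((cutPoints β c).card : ℝ) ≤ (2 : ℝ) ^ (N - 1) / (N : ℝ) ^ a →
      ∃ D : Finset (Fin N), (∀ b, b ∉ D → (rowSupp β b).card ≤ (Nat.log 2 N) ^ C) ∧
        (((univ.filter fun x : Fin N → Bool => IsOdd x ∧ ¬ BlockBalancedAt ((Nat.log 2 N) ^ C) D β c x).card : ℝ)
          ≤ ε * (2 : ℝ) ^ (N - 1))

/-- Auxiliary `hDrop_of_hBlock` of the joint-phase certificate engine (planner qa-qnc0-p1 g30, `Cert30.lean`, verbatim). -/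
theorem hDrop_of_hBlock (h : HBlock) : HDrop := by
  obtain ⟨δ₀, hδ₀, r₀, w₀, hW⟩ := h
  refine ⟨δ₀, hδ₀, r₀, w₀, fun ε hε => ?_⟩
  obtain ⟨C, a, n₀, hW⟩ := hW ε hε
  refine ⟨C, a, n₀, fun N hN β c hfr hcut => ?_⟩
  obtain ⟨D, hD, hcard⟩ := hW N hN β c hfr hcut
  refine ⟨D, hD, le_trans ?_ hcard⟩
  exact_mod_cast card_le_card fun x hx => by
    rw [mem_filter] at hx ⊢
    exact ⟨hx.1, hx.2.1, fun hB => hx.2.2 (blockBalanced_dropParity hB)⟩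

/-- Auxiliary `hAbs_of_hBlock` of the joint-phase certificate engine (planner qa-qnc0-p1 g30, `Cert30.lean`, verbatim). -/
theorem hAbs_of_hBlock (h : HBlock) : HAbs := hAbs_of_hDrop (hDrop_of_hBlock h)

/-- Auxiliary `polyLoss_of_hBlock` of the joint-phase certificate engine (planner qa-qnc0-p1 g30, `Cert30.lean`, verbatim). -/
theorem polyLoss_of_hBlock (h : HBlock) : AffBellsPolyLoss3 := polyLoss_of_hDrop (hDrop_of_hBlock h)


/-! ### §C.8 The PART-PARITY form `HPart` — the weakest typed target of the line: coherent parts each firing with parity `≡` its size.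
`HBlock → HPart → HDrop` (PROVED); the engine certifies `HPart`'s parts pointwise (`partParity_of_cert` = `desigParity_of_cert` with `W` = the part). -/

/-- PART PARITY at `x`: `dropAct D x` splits into pairwise disjoint parts, each coherent off at most `L` positions (up to unit signs) and each firing
with parity `≡` its size.  Weaker than `BlockBalancedAt` (balance only at the realised phase), still sufficient for `DropParityAt`, and exactly what the
radius-1 engine certifies part by part. -/
def PartParityAt (L : ℕ) (D : Finset (Fin N)) (β : Fin N → Fin N → ZMod 3) (c : Fin N → ZMod 3) (x : Fin N → Bool) : Prop :=
  ∃ (s : Finset (Finset (Fin N))) (ε : Fin N → ZMod 3) (T : Finset (Fin N) → Finset (Fin N)),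
    (∀ k ∈ s, ∀ k' ∈ s, k ≠ k' → Disjoint k k') ∧ s.biUnion id = dropAct D x ∧
    (∀ b ∈ dropAct D x, ε b = 1 ∨ ε b = 2) ∧
    (∀ k ∈ s, (T k).card ≤ L ∧ CoherentOff (T k) ε β x k) ∧
    (∀ k ∈ s, fires β c k x % 2 = k.card % 2)

/-- Part parity forces drop parity (PROVED; a sum). -/
theorem partParity_dropParity {L : ℕ} {D : Finset (Fin N)} {β : Fin N → Fin N → ZMod 3} {c : Fin N → ZMod 3} {x : Fin N → Bool}
    (h : PartParityAt L D β c x) : DropParityAt D β c x := by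
  obtain ⟨s, ε, T, hdisj, hU, -, -, hpar⟩ := h
  have hpart : ∀ k ∈ s, (fires β c k x : ZMod 2) = (k.card : ZMod 2) := fun k hk =>
    (ZMod.natCast_eq_natCast_iff' _ _ 2).mpr (hpar k hk)
  have hcard : (s.biUnion id).card = ∑ k ∈ s, k.card := card_biUnion hdisj
  unfold DropParityAt DesigParityAt
  rw [← ZMod.natCast_eq_natCast_iff', ← hU, fires_biUnion β c x s hdisj, hcard]
  push_cast
  exact sum_congr rfl fun k hk => hpart k hk

/-- Block balance is the stronger notion (PROVED): a signed-phase-balanced part fires with parity `≡` its size. -/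
theorem blockBalanced_partParity {L : ℕ} {D : Finset (Fin N)} {β : Fin N → Fin N → ZMod 3} {c : Fin N → ZMod 3} {x : Fin N → Bool}
    (h : BlockBalancedAt L D β c x) : PartParityAt L D β c x := by
  obtain ⟨s, ε, T, hdisj, hU, hε, hcoh, hbal⟩ := h
  have key : ∀ u v : ZMod 2, v = u + u + u → u = v := by decide
  refine ⟨s, ε, T, hdisj, hU, hε, hcoh, fun k hk => ?_⟩
  have hεk : ∀ g ∈ k, ε g = 1 ∨ ε g = 2 := fun g hg =>
    hε g (by rw [← hU, mem_biUnion]; exact ⟨k, hk, hg⟩)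
  have hsum : (k.card : ZMod 2) = (sPhaseCount β c x ε k 0 : ZMod 2) + sPhaseCount β c x ε k 1 + sPhaseCount β c x ε k 2 := by
    rw [← (sPhaseCount_sum β c x hεk)]; push_cast; rfl
  rw [← (hbal k hk).1, ← (hbal k hk).2] at hsum
  rw [← ZMod.natCast_eq_natCast_iff', ← sPhaseCount_zero β c x ε k]
  exact key _ _ hsum

/-- The engine certifies a part (PROVED; = `desigParity_of_cert` with `W` = the part): at a non-cut odd point a certificate shape designated on
`k ⊆ act x` gives `fires β c k x ≡ |k|`. -/
theorem partParity_of_cert (hN : 3 ≤ N) {β : Fin N → Fin N → ZMod 3} {c : Fin N → ZMod 3} {x : Fin N → Bool} {k : Finset (Fin N)}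
    (hk : k ⊆ act x) (hx : IsOdd x) (hnc : x ∉ cutPoints β c) (h : CertShapeW k β x) : fires β c k x % 2 = k.card % 2 :=
  desigParity_of_cert hN β c hk hx hnc h

/-- **`HPart`** — the PART-PARITY form (the weakest typed target of the line; `HBlock → HPart → HDrop`).  Far ∧ few cut points ⇒ a drop set `D` with
polylog-narrow complement such that a.e. the designated active rows split into coherent parts each firing with parity `≡` its size.
Why it might fail: as for `HBlock` — individually unbalanced wide blocks compensating inside the nullspace of the pair/class matrix on a positive fraction
of points; the realised-phase-only conclusion makes blind / coin-poor bottoms of link chains harmless only if their tables are balanced AT the realised phase. -/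
def HPart : Prop :=
  ∃ δ₀ : ℝ, δ₀ < 1 / 2 ∧ ∃ r₀ w₀ : ℕ, ∀ ε : ℝ, 0 < ε → ∃ C a n₀ : ℕ, ∀ N ≥ n₀, ∀ (β : Fin N → Fin N → ZMod 3) (c : Fin N → ZMod 3),
    ¬ FrameDecomp δ₀ r₀ w₀ β →
    ((cutPoints β c).card : ℝ) ≤ (2 : ℝ) ^ (N - 1) / (N : ℝ) ^ a →
      ∃ D : Finset (Fin N), (∀ b, b ∉ D → (rowSupp β b).card ≤ (Nat.log 2 N) ^ C) ∧
        (((univ.filter fun x : Fin N → Bool => IsOdd x ∧ ¬ PartParityAt ((Nat.log 2 N) ^ C) D β c x).card : ℝ)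
          ≤ ε * (2 : ℝ) ^ (N - 1))

/-- Auxiliary `hDrop_of_hPart` of the joint-phase certificate engine (planner qa-qnc0-p1 g30, `Cert30.lean`, verbatim). -/
theorem hDrop_of_hPart (h : HPart) : HDrop := by
  obtain ⟨δ₀, hδ₀, r₀, w₀, hW⟩ := h
  refine ⟨δ₀, hδ₀, r₀, w₀, fun ε hε => ?_⟩
  obtain ⟨C, a, n₀, hW⟩ := hW ε hε
  refine ⟨C, a, n₀, fun N hN β c hfr hcut => ?_⟩
  obtain ⟨D, hD, hcard⟩ := hW N hN β c hfr hcut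
  refine ⟨D, hD, le_trans ?_ hcard⟩
  exact_mod_cast card_le_card fun x hx => by
    rw [mem_filter] at hx ⊢
    exact ⟨hx.1, hx.2.1, fun hP => hx.2.2 (partParity_dropParity hP)⟩

/-- Auxiliary `hPart_of_hBlock` of the joint-phase certificate engine (planner qa-qnc0-p1 g30, `Cert30.lean`, verbatim). -/
theorem hPart_of_hBlock (h : HBlock) : HPart := by
  obtain ⟨δ₀, hδ₀, r₀, w₀, hW⟩ := h
  refine ⟨δ₀, hδ₀, r₀, w₀, fun ε hε => ?_⟩
  obtain ⟨C, a, n₀, hW⟩ := hW ε hε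
  refine ⟨C, a, n₀, fun N hN β c hfr hcut => ?_⟩
  obtain ⟨D, hD, hcard⟩ := hW N hN β c hfr hcut
  refine ⟨D, hD, le_trans ?_ hcard⟩
  exact_mod_cast card_le_card fun x hx => by
    rw [mem_filter] at hx ⊢
    exact ⟨hx.1, hx.2.1, fun hB => hx.2.2 (blockBalanced_partParity hB)⟩

/-- Auxiliary `hAbs_of_hPart` of the joint-phase certificate engine (planner qa-qnc0-p1 g30, `Cert30.lean`, verbatim). -/
theorem hAbs_of_hPart (h : HPart) : HAbs := hAbs_of_hDrop (hDrop_of_hPart h)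

/-- Auxiliary `polyLoss_of_hPart` of the joint-phase certificate engine (planner qa-qnc0-p1 g30, `Cert30.lean`, verbatim). -/
theorem polyLoss_of_hPart (h : HPart) : AffBellsPolyLoss3 := polyLoss_of_hDrop (hDrop_of_hPart h)


end AffBells30

end Summit.QuantumAdvantage.AdviceFreeQNC0
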